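import Mathlib
import Summits.Ventures.PercRepro2.PointSplitSourceLeaf

/-!
# The two-hub graph `K_{2,n}`: cluster law and route factorisation
(blind cell PercRepro2, night-3 g27, 2026-08-29; `proofs/NIGHT3-CERT.md` §35.9–35.10 / §36)

`K_{2,n}`: hubs `s = 0`, `v = 1`, leaves `ℓ + 2`, edges `(ℓ, false) = {s, ℓ}`, `(ℓ, true) = {ℓ, v}`.
The cluster law factorises over the routes: `v ∈ C_s` iff some route is fully open
(`conn_sv_iff`), and a leaf lies in `C_s` iff its hub edge is open or (its `v`-edge is open and
`v ∈ C_s`) (`leaf_mem_cluster_iff`).  At the uniform weight `1/2` the expectation of a product of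
route-local functions is the product of the route expectations (`expect_route_prod`,
`expect_all_routes`, `expect_routes_split`).  Used by `K2nPointSplitRefutation` to evaluate the
point-split forms in closed form.  Own work; standard axioms.
-/

namespace Summit.Ventures.PercRepro2

namespace K2n

/-- The leaf `ℓ` of `K_{2,n}` as a vertex of `Fin (n + 2)`. -/
def leaf {n : ℕ} (ℓ : Fin n) : Fin (n + 2) := ℓ.succ.succ

/-- A leaf is not the hub `s = 0`. -/
lemma leaf_ne_zero {n : ℕ} (ℓ : Fin n) : leaf ℓ ≠ 0 := by
  simp [leaf, Fin.ext_iff]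

/-- A leaf is not the hub `v = 1`. -/
lemma leaf_ne_one {n : ℕ} (ℓ : Fin n) : leaf ℓ ≠ 1 := by
  simp [leaf, Fin.ext_iff]

/-- Distinct leaves are distinct vertices. -/
lemma leaf_injective {n : ℕ} : Function.Injective (leaf (n := n)) := by
  intro a b h
  simpa [leaf] using h

/-- The two hubs are distinct. -/
lemma zero_ne_one' {n : ℕ} : (0 : Fin (n + 2)) ≠ 1 := by
  simp

/-- The edges of `K_{2,n}`: `(ℓ, false)` joins `s = 0` to the leaf, `(ℓ, true)` joins the leaf to `v = 1`. -/
def ends (n : ℕ) : Fin n × Bool → Sym2 (Fin (n + 2)) :=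
  fun e => if e.2 then s(leaf e.1, 1) else s(0, leaf e.1)

/-- The hub edge `(ℓ, false)` joins `s` to the leaf. -/
@[simp] lemma ends_false {n : ℕ} (ℓ : Fin n) : ends n (ℓ, false) = s(0, leaf ℓ) := rfl

/-- The `v`-edge `(ℓ, true)` joins the leaf to `v`. -/
@[simp] lemma ends_true {n : ℕ} (ℓ : Fin n) : ends n (ℓ, true) = s(leaf ℓ, 1) := rfl

/-- The open edges of a configuration at a vertex pair, explicitly. -/
lemma openAdj_iff {n : ℕ} (ω : Config (Fin n × Bool)) (x y : Fin (n + 2)) :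
    OpenAdj (ends n) ω x y ↔
      (∃ ℓ, ω (ℓ, false) = true ∧ ((x = 0 ∧ y = leaf ℓ) ∨ (x = leaf ℓ ∧ y = 0))) ∨
      (∃ ℓ, ω (ℓ, true) = true ∧ ((x = leaf ℓ ∧ y = 1) ∨ (x = 1 ∧ y = leaf ℓ))) := by
  constructor
  · rintro ⟨⟨ℓ, b⟩, hω, he⟩
    cases b
    · left
      refine ⟨ℓ, hω, ?_⟩
      rw [ends_false, Sym2.eq_iff] at he
      rcases he with ⟨h1, h2⟩ | ⟨h1, h2⟩
      · exact Or.inl ⟨h1.symm, h2.symm⟩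
      · exact Or.inr ⟨h2.symm, h1.symm⟩
    · right
      refine ⟨ℓ, hω, ?_⟩
      rw [ends_true, Sym2.eq_iff] at he
      rcases he with ⟨h1, h2⟩ | ⟨h1, h2⟩
      · exact Or.inl ⟨h1.symm, h2.symm⟩
      · exact Or.inr ⟨h2.symm, h1.symm⟩
  · rintro (⟨ℓ, hω, ⟨rfl, rfl⟩ | ⟨rfl, rfl⟩⟩ | ⟨ℓ, hω, ⟨rfl, rfl⟩ | ⟨rfl, rfl⟩⟩)
    · exact ⟨(ℓ, false), hω, rfl⟩
    · exact ⟨(ℓ, false), hω, by rw [ends_false, Sym2.eq_swap]⟩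
    · exact ⟨(ℓ, true), hω, rfl⟩
    · exact ⟨(ℓ, true), hω, by rw [ends_true, Sym2.eq_swap]⟩

/-- `s ↔ v` iff some route is fully open. -/
theorem conn_sv_iff {n : ℕ} (ω : Config (Fin n × Bool)) :
    Conn (ends n) ω 0 1 ↔ ∃ ℓ, ω (ℓ, false) = true ∧ ω (ℓ, true) = true := by
  constructor
  · intro h
    by_contra hno
    -- closure set: `s` together with the leaves whose hub edge is open
    let S : Set (Fin (n + 2)) := {x | x = 0 ∨ ∃ ℓ, x = leaf ℓ ∧ ω (ℓ, false) = true}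
    have hS : ∀ x ∈ S, ∀ y, (openGraph (ends n) ω).Adj x y → y ∈ S := by
      intro x hx y hxy
      rw [openGraph_adj] at hxy
      obtain ⟨-, hadj⟩ := hxy
      rw [openAdj_iff] at hadj
      rcases hadj with ⟨ℓ, hω, ⟨rfl, rfl⟩ | ⟨rfl, rfl⟩⟩ | ⟨ℓ, hω, ⟨rfl, rfl⟩ | ⟨rfl, rfl⟩⟩
      · exact Or.inr ⟨ℓ, rfl, hω⟩
      · exact Or.inl rfl
      · -- `x = leaf ℓ ∈ S` and the `v`-edge is open: the route would be fully open
        exfalso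
        rcases hx with hx | ⟨ℓ', hℓ', hω'⟩
        · exact leaf_ne_zero ℓ hx
        · have := leaf_injective hℓ'
          subst this
          exact hno ⟨ℓ, hω', hω⟩
      · -- `x = 1 ∈ S` is impossible
        exfalso
        rcases hx with hx | ⟨ℓ', hℓ', -⟩
        · exact zero_ne_one' hx.symm
        · exact leaf_ne_one ℓ' hℓ'.symm
    have h1 : (1 : Fin (n + 2)) ∈ S := mem_of_conn_of_closed hS (Or.inl rfl) h
    rcases h1 with h1 | ⟨ℓ, hℓ, -⟩
    · exact zero_ne_one' h1.symm
    · exact leaf_ne_one ℓ hℓ.symm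
  · rintro ⟨ℓ, h1, h2⟩
    have ha' : OpenAdj (ends n) ω 0 (leaf ℓ) := ⟨(ℓ, false), h1, rfl⟩
    have hb' : OpenAdj (ends n) ω (leaf ℓ) 1 := ⟨(ℓ, true), h2, rfl⟩
    exact conn_trans (conn_of_openAdj ha') (conn_of_openAdj hb')

/-- A leaf lies in `C_s` iff its hub edge is open, or its `v`-edge is open and `s ↔ v`. -/
theorem leaf_mem_cluster_iff {n : ℕ} (ω : Config (Fin n × Bool)) (ℓ : Fin n) :
    leaf ℓ ∈ cluster (ends n) ω 0 ↔
      ω (ℓ, false) = true ∨ (ω (ℓ, true) = true ∧ Conn (ends n) ω 0 1) := by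
  constructor
  · intro h
    rw [mem_cluster] at h
    by_cases hf : ω (ℓ, false) = true
    · exact Or.inl hf
    · right
      have hf' : ω (ℓ, false) = false := by simpa using hf
      -- closure set: everything connected to `s`, with the leaf `ℓ` only if `s ↔ v`
      let S : Set (Fin (n + 2)) := {x | Conn (ends n) ω 0 x ∧ (x = leaf ℓ → Conn (ends n) ω 0 1)}
      have hS : ∀ x ∈ S, ∀ y, (openGraph (ends n) ω).Adj x y → y ∈ S := by
        intro x hx y hxy
        have hconn : Conn (ends n) ω 0 y := conn_trans hx.1 (SimpleGraph.Adj.reachable hxy)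
        refine ⟨hconn, fun hy => ?_⟩
        subst hy
        rw [openGraph_adj] at hxy
        obtain ⟨-, hadj⟩ := hxy
        rw [openAdj_iff] at hadj
        rcases hadj with ⟨ℓ', hω, ⟨rfl, hy⟩ | ⟨hy, hy'⟩⟩ | ⟨ℓ', hω, ⟨hy, hy'⟩ | ⟨rfl, hy⟩⟩
        · -- the hub edge of `ℓ` is closed
          have := leaf_injective hy
          subst this
          rw [hf'] at hω
          exact absurd hω Bool.false_ne_true
        · exact absurd hy' (leaf_ne_zero ℓ)
        · exact absurd hy' (leaf_ne_one ℓ)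
        · -- `x = 1`: so `s ↔ v`
          exact hx.1
      have hmem : leaf ℓ ∈ S := mem_of_conn_of_closed hS ⟨conn_refl _ _ _, fun h0 => absurd h0.symm (leaf_ne_zero ℓ)⟩ h
      have hsv := hmem.2 rfl
      refine ⟨?_, hsv⟩
      -- the `v`-edge must be open: otherwise the leaf is isolated
      by_contra ht
      have ht' : ω (ℓ, true) = false := by simpa using ht
      let T : Set (Fin (n + 2)) := {x | x ≠ leaf ℓ}
      have hT : ∀ x ∈ T, ∀ y, (openGraph (ends n) ω).Adj x y → y ∈ T := by
        intro x hx y hxy hy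
        subst hy
        rw [openGraph_adj] at hxy
        obtain ⟨-, hadj⟩ := hxy
        rw [openAdj_iff] at hadj
        rcases hadj with ⟨ℓ', hω, ⟨rfl, hy⟩ | ⟨hy, hy'⟩⟩ | ⟨ℓ', hω, ⟨hy, hy'⟩ | ⟨rfl, hy⟩⟩
        · have := leaf_injective hy
          subst this
          rw [hf'] at hω
          exact absurd hω Bool.false_ne_true
        · exact leaf_ne_zero ℓ hy'
        · exact leaf_ne_one ℓ hy'
        · have := leaf_injective hy
          subst this
          rw [ht'] at hω
          exact absurd hω Bool.false_ne_true
      exact mem_of_conn_of_closed hT (fun h0 => leaf_ne_zero ℓ h0.symm) h rfl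
  · rintro (hf | ⟨ht, hsv⟩)
    · have ha' : OpenAdj (ends n) ω 0 (leaf ℓ) := ⟨(ℓ, false), hf, rfl⟩
      exact conn_of_openAdj ha'
    · have hb' : OpenAdj (ends n) ω 1 (leaf ℓ) := ⟨(ℓ, true), ht, by rw [ends_true, Sym2.eq_swap]⟩
      exact conn_trans hsv (conn_of_openAdj hb')


/-! ## The route map and the uniform weight `1/2` -/

/-- A configuration of `K_{2,n}` as its route states `(hub edge, v-edge)`. -/
def routeEquiv (n : ℕ) : Config (Fin n × Bool) ≃ (Fin n → Bool × Bool) where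
  toFun ω := fun ℓ => (ω (ℓ, false), ω (ℓ, true))
  invFun f := fun e => if e.2 then (f e.1).2 else (f e.1).1
  left_inv ω := by
    funext ⟨ℓ, b⟩
    cases b <;> rfl
  right_inv f := by
    funext ℓ
    rfl

/-- First route coordinate: the hub edge. -/
@[simp] lemma routeEquiv_fst {n : ℕ} (ω : Config (Fin n × Bool)) (ℓ : Fin n) :
    (routeEquiv n ω ℓ).1 = ω (ℓ, false) := rfl

/-- Second route coordinate: the `v`-edge. -/
@[simp] lemma routeEquiv_snd {n : ℕ} (ω : Config (Fin n × Bool)) (ℓ : Fin n) :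
    (routeEquiv n ω ℓ).2 = ω (ℓ, true) := rfl

/-- The uniform edge weight `1/2`. -/
def half (n : ℕ) : Fin n × Bool → ℚ := fun _ => 1 / 2

/-- The uniform weight `1/2` is admissible. -/
lemma isProbVec_half (n : ℕ) : IsProbVec (half n) :=
  ⟨fun _ => by norm_num [half], fun _ => by norm_num [half]⟩

/-- Every Bernoulli factor at weight `1/2` is `1/2`. -/
lemma edgeFactor_half (b : Bool) : edgeFactor (1 / 2 : ℚ) b = 1 / 2 := by
  cases b <;> norm_num [edgeFactor]

/-- At weight `1/2` every configuration of `K_{2,n}` has weight `(1/4)^n`. -/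
lemma weight_half {n : ℕ} (ω : Config (Fin n × Bool)) : weight (half n) ω = (1 / 4 : ℚ) ^ n := by
  unfold weight
  simp only [half, edgeFactor_half, Finset.prod_const, Finset.card_univ, Fintype.card_prod,
    Fintype.card_fin, Fintype.card_bool]
  rw [mul_comm, pow_mul]
  norm_num

/-- **Route factorisation** at weight `1/2`: the expectation of a product of route-local functions
is the product of the route expectations. -/
theorem expect_route_prod {n : ℕ} (g : Fin n → Bool × Bool → ℚ) :
    expect (half n) (fun ω => ∏ ℓ, g ℓ (routeEquiv n ω ℓ)) =
      ∏ ℓ, ((1 / 4 : ℚ) * ∑ ρ : Bool × Bool, g ℓ ρ) := by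
  unfold expect
  simp only [weight_half]
  rw [← Finset.mul_sum]
  rw [Fintype.sum_equiv (routeEquiv n) (fun ω => ∏ ℓ, g ℓ (routeEquiv n ω ℓ))
    (fun f => ∏ ℓ, g ℓ (f ℓ)) (fun ω => rfl)]
  rw [← Fintype.prod_sum, Finset.prod_mul_distrib, Finset.prod_const, Finset.card_univ,
    Fintype.card_fin]

/-- The expectation of the indicator of «every route satisfies `Φ ℓ`». -/
theorem expect_all_routes {n : ℕ} (Φ : Fin n → Bool × Bool → Prop) [∀ ℓ, DecidablePred (Φ ℓ)] :
    expect (half n) (fun ω => if ∀ ℓ, Φ ℓ (routeEquiv n ω ℓ) then (1 : ℚ) else 0) =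
      ∏ ℓ, ((1 / 4 : ℚ) * ∑ ρ : Bool × Bool, if Φ ℓ ρ then (1 : ℚ) else 0) := by
  rw [← expect_route_prod (fun ℓ ρ => if Φ ℓ ρ then (1 : ℚ) else 0)]
  refine congrArg _ (funext fun ω => ?_)
  by_cases h : ∀ ℓ, Φ ℓ (routeEquiv n ω ℓ)
  · rw [if_pos h]
    exact (Finset.prod_eq_one fun ℓ _ => if_pos (h ℓ)).symm
  · rw [if_neg h]
    push Not at h
    obtain ⟨ℓ₀, hℓ₀⟩ := h
    exact (Finset.prod_eq_zero (Finset.mem_univ ℓ₀) (if_neg hℓ₀)).symm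

/-- A product over the leaves that is `c` on `B` and `d` off `B`. -/
lemma prod_ite_mem_card {n : ℕ} (B : Finset (Fin n)) (c d : ℚ) :
    ∏ ℓ, (if ℓ ∈ B then c else d) = c ^ B.card * d ^ (n - B.card) := by
  rw [Finset.prod_ite, Finset.prod_const, Finset.prod_const, Finset.filter_mem_eq_inter,
    Finset.univ_inter, Finset.filter_not, Finset.filter_mem_eq_inter, Finset.univ_inter,
    Finset.card_univ_sdiff, Fintype.card_fin]

/-! ## Route predicates -/

/-- «route ≠ 00»: some edge of the route is open. -/
def ne00 (ρ : Bool × Bool) : Bool := ρ.1 || ρ.2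

/-- «route not fully open». -/
def nrr (ρ : Bool × Bool) : Bool := !(ρ.1 && ρ.2)

/-- «route = 10»: the hub edge open, the `v`-edge closed. -/
def eq10 (ρ : Bool × Bool) : Bool := ρ.1 && !ρ.2

/-- Three of the four route states have an open edge. -/
lemma sum_ne00 : ∑ ρ : Bool × Bool, (if ne00 ρ = true then (1 : ℚ) else 0) = 3 := by
  simp only [Fintype.sum_prod_type, Fintype.sum_bool]
  norm_num [ne00]

/-- One route state is `10`. -/
lemma sum_eq10 : ∑ ρ : Bool × Bool, (if eq10 ρ = true then (1 : ℚ) else 0) = 1 := by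
  simp only [Fintype.sum_prod_type, Fintype.sum_bool]
  norm_num [eq10]

/-- Three of the four route states are not fully open. -/
lemma sum_nrr : ∑ ρ : Bool × Bool, (if nrr ρ = true then (1 : ℚ) else 0) = 3 := by
  simp only [Fintype.sum_prod_type, Fintype.sum_bool]
  norm_num [nrr]


/-- The constant route predicate «true». -/
def tt (_ : Bool × Bool) : Bool := true

/-- «route ∈ {10, 01}»: some edge open, not both. -/
def ne00nrr (ρ : Bool × Bool) : Bool := ne00 ρ && nrr ρ

/-- All four route states satisfy `tt`. -/
lemma sum_tt : ∑ ρ : Bool × Bool, (if tt ρ = true then (1 : ℚ) else 0) = 4 := by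
  simp only [Fintype.sum_prod_type, Fintype.sum_bool, tt]
  norm_num

/-- `ne00` on a route of `ω`, unfolded. -/
lemma ne00_iff {n : ℕ} (ω : Config (Fin n × Bool)) (ℓ : Fin n) :
    ne00 (routeEquiv n ω ℓ) = true ↔ (ω (ℓ, false) = true ∨ ω (ℓ, true) = true) := by
  rcases Bool.eq_false_or_eq_true (ω (ℓ, false)) with h1 | h1 <;>
    rcases Bool.eq_false_or_eq_true (ω (ℓ, true)) with h2 | h2 <;> simp [ne00, h1, h2]

/-- `nrr` on a route of `ω`, unfolded. -/
lemma nrr_iff {n : ℕ} (ω : Config (Fin n × Bool)) (ℓ : Fin n) :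
    nrr (routeEquiv n ω ℓ) = true ↔ ¬ (ω (ℓ, false) = true ∧ ω (ℓ, true) = true) := by
  rcases Bool.eq_false_or_eq_true (ω (ℓ, false)) with h1 | h1 <;>
    rcases Bool.eq_false_or_eq_true (ω (ℓ, true)) with h2 | h2 <;> simp [nrr, h1, h2]

/-- `eq10` on a route of `ω`, unfolded. -/
lemma eq10_iff {n : ℕ} (ω : Config (Fin n × Bool)) (ℓ : Fin n) :
    eq10 (routeEquiv n ω ℓ) = true ↔ (ω (ℓ, false) = true ∧ ω (ℓ, true) = false) := by
  rcases Bool.eq_false_or_eq_true (ω (ℓ, false)) with h1 | h1 <;>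
    rcases Bool.eq_false_or_eq_true (ω (ℓ, true)) with h2 | h2 <;> simp [eq10, h1, h2]

/-- The per-route sum of a predicate that is `φ` on `B` and `ψ` off `B`. -/
lemma sum_ite_mem_route {n : ℕ} (B : Finset (Fin n)) (ℓ : Fin n) (φ ψ : Bool × Bool → Bool) :
    (∑ ρ : Bool × Bool, if (ℓ ∈ B → φ ρ = true) ∧ (ℓ ∉ B → ψ ρ = true) then (1 : ℚ) else 0) =
      if ℓ ∈ B then (∑ ρ : Bool × Bool, if φ ρ = true then (1 : ℚ) else 0)
      else (∑ ρ : Bool × Bool, if ψ ρ = true then (1 : ℚ) else 0) := by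
  by_cases h : ℓ ∈ B <;> simp [h]

/-- The expectation of «`φ` on every route of `B`, `ψ` on every route off `B`», in closed form. -/
theorem expect_routes_split {n : ℕ} (B : Finset (Fin n)) (φ ψ : Bool × Bool → Bool) :
    expect (half n) (fun ω => if ∀ ℓ, (ℓ ∈ B → φ (routeEquiv n ω ℓ) = true) ∧
        (ℓ ∉ B → ψ (routeEquiv n ω ℓ) = true) then (1 : ℚ) else 0) =
      ((1 / 4 : ℚ) * ∑ ρ : Bool × Bool, if φ ρ = true then (1 : ℚ) else 0) ^ B.card *
        ((1 / 4 : ℚ) * ∑ ρ : Bool × Bool, if ψ ρ = true then (1 : ℚ) else 0) ^ (n - B.card) := by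
  rw [expect_all_routes (fun ℓ ρ => (ℓ ∈ B → φ ρ = true) ∧ (ℓ ∉ B → ψ ρ = true))]
  rw [← prod_ite_mem_card]
  refine Finset.prod_congr rfl fun ℓ _ => ?_
  rw [sum_ite_mem_route, mul_ite]

/-- `expect` is additive (difference form, pointwise lambda). -/
lemma expect_sub' {n : ℕ} (f g : Config (Fin n × Bool) → ℚ) :
    expect (half n) (fun ω => f ω - g ω) = expect (half n) f - expect (half n) g :=
  expect_sub (half n) f g

/-- `expect` is additive (sum form, pointwise lambda). -/
lemma expect_add' {n : ℕ} (f g : Config (Fin n × Bool) → ℚ) :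
    expect (half n) (fun ω => f ω + g ω) = expect (half n) f + expect (half n) g :=
  expect_add (half n) f g

end K2n

end Summit.Ventures.PercRepro2
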